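import Literature.MathematicalPhysics.QuantumFieldTheory.Balaban1983to89.T4TriangularFibredChart

/-!
# DAG node N11 — THE PRIVATE-COORDINATE FIBRED CHART WITH A KEPT OUTSIDE PARAMETER (generic engine for the INNER chart of a skew averaging): dag-n09-w6's chart of a product
# measure run per outside value and integrated, in dag-n11-d's inner-socket orientation

HEADER — WORK-UNIT METADATA.  Cell `pub-ymgap`, YM-PLAN Track A (HUMAN RULING D-0062 ∕ D-0149 ∕ D-0154 (3a)), WIDTH SEAT `pub-ymgap-dag-n11-w6` (g2) on node N11 [B14];
route `BalabanUVNodes`, key item K1⁷ `StabilityBAtRecordR13SepCoPH` = stmt-QuantumFields-20542 (helper lane, `--kind proof --supports 20542 --as helper`, count-neutral).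
[I] = [Balaban1987RG1], [III] = [Balaban1988Convergent].  Bus: CLAIM-3 = INTENT-3 of this seat (R455 (A)) — file 3a (generic half; file 3b `…N11InnerTransportInPrivateCoordinateChart`
is the record reading).  Over dag-n09-w6 g3's `T4TriangularFibredChart` (p616307 ★★★ `pi_restrict_preimage_inter_eq_map_prod_withDensity`: per ENVIRONMENT, per-bond inversion
data ⟹ the private-coordinate chart of `Measure.pi`) and Mathlib only.

WHY THIS FILE.  The SEPARATED one-step transport of [III] (2.21) («`∫dV|_{Ω^c_{k+1}} δ(V̄V′⁻¹) … ∫dA|_{Ω_{k+1}} …`») keeps the OUTSIDE fine field `y` un-charted and charts only the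
inside; dag-n11-d's inner socket (p612397 ∕ p616225) accordingly asks for a chart `(κ, Ψ, J, S)` of the inner step `(y, r) ↦ (y, a_in(y, r))` with `hpush : ((((ρ_out ⊗ μ_rest) ⊗ₘ κ)·J).map
((w, x) ↦ (w.1, Ψ(w, x))) = (ρ_out ⊗ ν_in)⌊S` — the outside variable is BOTH an input of the one-variable maps and a kept output coordinate.  p616307 is the `y`-free case.  THIS
FILE runs p616307 for a measurably parametrised family `A y : (ι → G) → (κ → G)` of `β`-local maps with per-bond data depending on the pair `(y, U)`, and integrates the family of
`y`-section chart identities over `y` (§1: evaluate on a measurable set, Tonelli twice, the section identity on the section — no π-system needed), delivering exactly the inner-socket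
shape with the CONSTANT fibre reference `Kernel.const _ μ^ι` (§2), plus the parametrised `hfib`, and the measurability of the chart ∕ Jacobian ∕ charted set for consumers.

WHAT THIS FILE PROVES (0 `def`, 0 `sorry`, standard axioms; generic measurable spaces).
§1 `map_withDensity_prod_eq_restrict_of_forall` (FIBREWISE CHART IDENTITIES INTEGRATE over a kept parameter).
§2 `measurable_triChartParam` · `measurableSet_triJacobianParamSupport` · `measurable_triJacobianParam` · `measurableSet_fineDomainParam` · ★★ `triChart_param_map_eq_restrict` (the
inner `hpush`: `((((ρ₁ ⊗ ν^κ) ⊗ₘ Kernel.const _ μ^ι)·J).map (z ↦ (z.1.1, Φ z)) = (ρ₁ ⊗ μ^ι)⌊{(y,U) | ∀ c, U(β c) ∈ Ω_c(y,U)}`) · ★ `ae_apply_triChart_param_eq` (the inner `hfib`, any base measure).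

HONEST FRAMING.  Helper lane of K1⁷; count-neutral; [folklore] measure theory (`Measure.compProd_const`, `Measure.prod_apply`, `lintegral_prod`, `withDensity`∕`map`∕`restrict` algebra)
over p616307; per-bond inversion data are HYPOTHESES; no chart of Bałaban's ((47), [III] (3.10)–(3.25)) asserted; nothing at the record here (file 3b); (B4) ∕ (S-α) NOT closed; N11
NOT discharged; K1⁷ ∕ K1⁸ NOT closed, no registered stub touched; counts unmoved (typed 28∕28 · discharged 5∕27 · A 5∕28).  No summit statement is proved by this seat.  One finite
`𝕋⁴_{L^K}` programme at fixed `ε = L^{−K}`; R4 closes only the conditional finite-𝕋⁴ rung `BalabanLadder.UV` — NOT ℝ⁴, NOT OS, NOT a mass gap, NOT Clay.  No `sorry`, `axiom`, `def`,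
`instance`, `notation`.  Sources (SHAPE ∕ bookkeeping only): [I] (0.4) p.253, (2.4) p.266, (2.10) p.267; [III] (2.21) p.258, p.267 L18–24.
-/

noncomputable section

open MeasureTheory ProbabilityTheory Set Function
open scoped ENNReal NNReal

namespace Summit.QuantumFields.YangMills.Theorems.BalabanUVNodesN11PrivateCoordinateChartKeptParameter

open Literature.MathematicalPhysics.QuantumFieldTheory.Balaban1983to89
open Literature.MathematicalPhysics.QuantumFieldTheory.Balaban1983to89.T4TriangularPushforward (IsLocal apply_resample_eq measurable_resample)
open Literature.MathematicalPhysics.QuantumFieldTheory.Balaban1983to89.T4TriangularFibredChart (pi_restrict_preimage_inter_eq_map_prod_withDensity)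

/-! ## §1  Fibrewise chart identities integrate over a kept parameter -/

section Integrate

variable {Y W U : Type*} [MeasurableSpace Y] [MeasurableSpace W] [MeasurableSpace U]

/-- **FIBREWISE CHART IDENTITIES INTEGRATE OVER A KEPT PARAMETER.**  Outside parameter `y ∼ ρ₁` (kept as an output coordinate), coarse-rest reference `πκ`, fine-rest reference
`πι` (all s-finite); a jointly measurable chart `Φ : (Y × W) × U → U` and Jacobian `J`; a measurable charted set `S ⊆ Y × U`.  If for EVERY `y` the `y`-section identity
`(((πκ ⊗ πι)·J((y,·),·)).map Φ((y,·),·) = πι⌊S_y` holds, then `((((ρ₁ ⊗ πκ) ⊗ₘ Kernel.const _ πι)·J).map (z ↦ (z.1.1, Φ z)) = (ρ₁ ⊗ πι)⌊S` — the INNER-chart `hpush` shape of a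
skew product (outside fine variable kept, inside charted).  Proof: evaluate both sides on a measurable set, Tonelli twice, the section identity on the section of the set.
[cite: Balaban1988Convergent, (2.21) p.258 (bookkeeping: outside variables kept, inside variables integrated)] -/
theorem map_withDensity_prod_eq_restrict_of_forall (ρ₁ : Measure Y) [SFinite ρ₁] (πκ : Measure W) [SFinite πκ] (πι : Measure U) [SFinite πι]
    {Φ : (Y × W) × U → U} (hΦ : Measurable Φ) {J : (Y × W) × U → ℝ≥0∞} (hJ : Measurable J) {S : Set (Y × U)} (hS : MeasurableSet S)
    (hsec : ∀ y, ((πκ.prod πι).withDensity (fun p => J ((y, p.1), p.2))).map (fun p => Φ ((y, p.1), p.2)) = πι.restrict (Prod.mk y ⁻¹' S)) :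
    (((ρ₁.prod πκ) ⊗ₘ Kernel.const (Y × W) πι).withDensity J).map (fun z => (z.1.1, Φ z)) = (ρ₁.prod πι).restrict S := by
  have hF : Measurable fun z : (Y × W) × U => (z.1.1, Φ z) := measurable_fst.fst.prodMk hΦ
  rw [Measure.compProd_const]
  ext s hs
  rw [Measure.map_apply hF hs, withDensity_apply _ (hF hs), Measure.restrict_apply hs,
    Measure.prod_apply (hs.inter hS), ← lintegral_indicator (hF hs),
    lintegral_prod _ ((hJ.indicator (hF hs)).aemeasurable),
    lintegral_prod _ (((hJ.indicator (hF hs)).lintegral_prod_right').aemeasurable)]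
  refine lintegral_congr fun y => ?_
  have hsy : MeasurableSet (Prod.mk y ⁻¹' s) := measurable_prodMk_left hs
  have hΦy : Measurable fun p : W × U => Φ ((y, p.1), p.2) :=
    hΦ.comp ((measurable_const.prodMk measurable_fst).prodMk measurable_snd)
  have hJy : Measurable fun p : W × U => J ((y, p.1), p.2) :=
    hJ.comp ((measurable_const.prodMk measurable_fst).prodMk measurable_snd)
  have hind : ∀ v u, ((fun z : (Y × W) × U => (z.1.1, Φ z)) ⁻¹' s).indicator J ((y, v), u) =
      ((fun p : W × U => Φ ((y, p.1), p.2)) ⁻¹' (Prod.mk y ⁻¹' s)).indicator (fun p => J ((y, p.1), p.2)) (v, u) := by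
    intro v u
    rfl
  have h1 : ∫⁻ v, ∫⁻ u, ((fun z : (Y × W) × U => (z.1.1, Φ z)) ⁻¹' s).indicator J ((y, v), u) ∂πι ∂πκ =
      ∫⁻ p, ((fun p : W × U => Φ ((y, p.1), p.2)) ⁻¹' (Prod.mk y ⁻¹' s)).indicator (fun p => J ((y, p.1), p.2)) p ∂(πκ.prod πι) := by
    rw [lintegral_prod _ ((hJy.indicator (hΦy hsy)).aemeasurable)]
    simp_rw [hind]
  rw [h1, lintegral_indicator (hΦy hsy), ← withDensity_apply _ (hΦy hsy), ← Measure.map_apply hΦy hsy, hsec y,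
    Measure.restrict_apply hsy]
  rfl

end Integrate

/-! ## §2  The private-coordinate chart of a product measure with a kept outside parameter, in the inner-socket orientation -/

section Param

variable {Y ι κ G : Type*} [MeasurableSpace Y] [Fintype ι] [Fintype κ] [DecidableEq ι] [MeasurableSpace G]
  {β : κ → ι} {A : Y → (ι → G) → (κ → G)}
  (Ω T : κ → Y × (ι → G) → Set G) (θ : κ → Y × (ι → G) → G → G) (j : κ → Y × (ι → G) → G → ℝ≥0)

omit [Fintype κ] [DecidableEq ι] in
/-- The parametrised resampled chart `z = ((y, V), U) ↦ extend β (c ↦ θ_c((y,U), V c)) U` is measurable. [cite: Balaban1987RG1, (2.10) p.267 (bookkeeping: measurability)] -/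
theorem measurable_triChartParam (hβ : Injective β) (hθm : ∀ c, Measurable fun p : (Y × (ι → G)) × G => θ c p.1 p.2) :
    Measurable fun z : (Y × (κ → G)) × (ι → G) => extend β (fun c => θ c (z.1.1, z.2) (z.1.2 c)) z.2 := by
  have h1 : Measurable fun z : (Y × (κ → G)) × (ι → G) => (z.2, fun c => θ c (z.1.1, z.2) (z.1.2 c)) :=
    measurable_snd.prodMk (measurable_pi_lambda _ fun c =>
      (hθm c).comp ((measurable_fst.fst.prodMk measurable_snd).prodMk ((measurable_pi_apply c).comp measurable_fst.snd)))
  exact (measurable_resample hβ).comp h1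

omit [Fintype ι] [DecidableEq ι] in
/-- The support `{((y,V),U) | ∀ c, V c ∈ T_c(y,U)}` of the parametrised Jacobian is measurable. [cite: Balaban1987RG1, (2.9) p.266 (bookkeeping: measurability)] -/
theorem measurableSet_triJacobianParamSupport (hTm : ∀ c, MeasurableSet {p : (Y × (ι → G)) × G | p.2 ∈ T c p.1}) :
    MeasurableSet {z : (Y × (κ → G)) × (ι → G) | ∀ c, z.1.2 c ∈ T c (z.1.1, z.2)} := by
  have : {z : (Y × (κ → G)) × (ι → G) | ∀ c, z.1.2 c ∈ T c (z.1.1, z.2)} =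
      ⋂ c, (fun z : (Y × (κ → G)) × (ι → G) => (((z.1.1, z.2) : Y × (ι → G)), z.1.2 c)) ⁻¹' {p : (Y × (ι → G)) × G | p.2 ∈ T c p.1} := by
    ext z; simp
  rw [this]
  exact MeasurableSet.iInter fun c =>
    ((measurable_fst.fst.prodMk measurable_snd).prodMk ((measurable_pi_apply c).comp measurable_fst.snd)) (hTm c)

omit [Fintype ι] [DecidableEq ι] in
/-- The parametrised Jacobian `((y,V),U) ↦ 𝟙[∀ c, V c ∈ T_c(y,U)]·∏_c j_c((y,U), V c)` is measurable (as an `ℝ≥0`-valued map). [cite: Balaban1987RG1, (2.10) p.267 (bookkeeping)] -/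
theorem measurable_triJacobianParam (hTm : ∀ c, MeasurableSet {p : (Y × (ι → G)) × G | p.2 ∈ T c p.1})
    (hjm : ∀ c, Measurable fun p : (Y × (ι → G)) × G => j c p.1 p.2) :
    Measurable fun z : (Y × (κ → G)) × (ι → G) =>
      {z : (Y × (κ → G)) × (ι → G) | ∀ c, z.1.2 c ∈ T c (z.1.1, z.2)}.indicator (fun z => ∏ c, j c (z.1.1, z.2) (z.1.2 c)) z := by
  refine Measurable.indicator ?_ (measurableSet_triJacobianParamSupport T hTm)
  exact Finset.measurable_prod _ fun c _ =>
    (hjm c).comp ((measurable_fst.fst.prodMk measurable_snd).prodMk ((measurable_pi_apply c).comp measurable_fst.snd))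

omit [Fintype ι] [DecidableEq ι] in
/-- The parametrised charted fine set `{(y,U) | ∀ c, U(β c) ∈ Ω_c(y,U)}` is measurable. [cite: Balaban1987RG1, (2.9) p.266 (bookkeeping)] -/
theorem measurableSet_fineDomainParam (hΩm : ∀ c, MeasurableSet {p : (Y × (ι → G)) × G | p.2 ∈ Ω c p.1}) :
    MeasurableSet {e : Y × (ι → G) | ∀ c, e.2 (β c) ∈ Ω c e} := by
  have : {e : Y × (ι → G) | ∀ c, e.2 (β c) ∈ Ω c e} = ⋂ c, (fun e : Y × (ι → G) => (e, e.2 (β c))) ⁻¹' {p : (Y × (ι → G)) × G | p.2 ∈ Ω c p.1} := by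
    ext e; simp
  rw [this]
  exact MeasurableSet.iInter fun c => (measurable_id.prodMk ((measurable_pi_apply (β c)).comp measurable_snd)) (hΩm c)

variable (μ : Measure G) [IsProbabilityMeasure μ] (ν : Measure G) [SigmaFinite ν] (ρ₁ : Measure Y) [SFinite ρ₁]

/-- **★★ THE PRIVATE-COORDINATE CHART WITH A KEPT OUTSIDE PARAMETER** (p616307 ★★★ `pi_restrict_preimage_inter_eq_map_prod_withDensity` PER outside value `y` at `U₀ = univ`,
integrated by §1): a family `A y : (ι → G) → (κ → G)` of `β`-local maps (`β` injective), jointly measurable in `(y, U)`, with per-bond inversion data depending on the PAIR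
`e = (y, U)` — fine windows `Ω_c(e)` blind to the private coordinates of `U`, coarse windows `T_c(e)`, inverses `θ_c(e,·)` (`hright`), densities `j_c(e,·)` with the inverse laws (`hlaw`)
— ⟹ `((((ρ₁ ⊗ ν^κ) ⊗ₘ Kernel.const _ μ^ι)·J).map (z ↦ (z.1.1, Φ z)) = (ρ₁ ⊗ μ^ι)⌊{(y,U) | ∀ c, U(β c) ∈ Ω_c(y,U)}` with `Φ ((y,V),U) = extend β (c ↦ θ_c((y,U), V c)) U`,
`J ((y,V),U) = 𝟙[∀ c, V c ∈ T_c(y,U)]·∏_c j_c((y,U), V c)`. [cite: Balaban1987RG1, (0.4) p.253, (2.4) p.266 and (2.10) p.267; Balaban1988Convergent, (2.21) p.258 (bookkeeping)] -/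
theorem triChart_param_map_eq_restrict [Nonempty G] (hA : ∀ y, IsLocal β (A y)) (hβ : Injective β)
    (hAm : Measurable fun p : Y × (ι → G) => A p.1 p.2)
    (hΩm : ∀ c, MeasurableSet {p : (Y × (ι → G)) × G | p.2 ∈ Ω c p.1})
    (hTm : ∀ c, MeasurableSet {p : (Y × (ι → G)) × G | p.2 ∈ T c p.1})
    (hθm : ∀ c, Measurable fun p : (Y × (ι → G)) × G => θ c p.1 p.2)
    (hjm : ∀ c, Measurable fun p : (Y × (ι → G)) × G => j c p.1 p.2)
    (hΩbl : ∀ c y (U : ι → G) (g : κ → G), Ω c (y, extend β g U) = Ω c (y, U))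
    (hright : ∀ c e, ∀ v ∈ T c e, A e.1 (update e.2 (β c) (θ c e v)) c = v)
    (hlaw : ∀ c e, μ.restrict (Ω c e) = ((ν.restrict (T c e)).withDensity fun v => (j c e v : ℝ≥0∞)).map (θ c e)) :
    (((ρ₁.prod (Measure.pi fun _ : κ => ν)) ⊗ₘ Kernel.const (Y × (κ → G)) (Measure.pi fun _ : ι => μ)).withDensity fun z =>
        (({z : (Y × (κ → G)) × (ι → G) | ∀ c, z.1.2 c ∈ T c (z.1.1, z.2)}.indicator
          (fun z => ∏ c, j c (z.1.1, z.2) (z.1.2 c)) z : ℝ≥0) : ℝ≥0∞)).map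
      (fun z : (Y × (κ → G)) × (ι → G) => (z.1.1, extend β (fun c => θ c (z.1.1, z.2) (z.1.2 c)) z.2)) =
    (ρ₁.prod (Measure.pi fun _ : ι => μ)).restrict {e : Y × (ι → G) | ∀ c, e.2 (β c) ∈ Ω c e} := by
  classical
  have hsec : ∀ y, Measurable fun U : ι → G => ((y, U) : Y × (ι → G)) := fun y => measurable_const.prodMk measurable_id
  refine map_withDensity_prod_eq_restrict_of_forall ρ₁ (Measure.pi fun _ : κ => ν) (Measure.pi fun _ : ι => μ) (measurable_triChartParam θ hβ hθm)
    (measurable_coe_nnreal_ennreal.comp (measurable_triJacobianParam T j hTm hjm)) (measurableSet_fineDomainParam Ω hΩm) fun y => ?_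
  -- the `y`-section is p616307's chart of `A y` with the `y`-section data
  have hΩy : ∀ c, MeasurableSet {p : (ι → G) × G | p.2 ∈ (fun c U => Ω c (y, U)) c p.1} := fun c =>
    ((hsec y).comp measurable_fst |>.prodMk measurable_snd) (hΩm c)
  have hTy : ∀ c, MeasurableSet {p : (ι → G) × G | p.2 ∈ (fun c U => T c (y, U)) c p.1} := fun c =>
    ((hsec y).comp measurable_fst |>.prodMk measurable_snd) (hTm c)
  have hθy : ∀ c, Measurable fun p : (ι → G) × G => (fun c U g => θ c (y, U) g) c p.1 p.2 := fun c =>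
    (hθm c).comp ((hsec y).comp measurable_fst |>.prodMk measurable_snd)
  have hjy : ∀ c, Measurable fun p : (ι → G) × G => (fun c U g => j c (y, U) g) c p.1 p.2 := fun c =>
    (hjm c).comp ((hsec y).comp measurable_fst |>.prodMk measurable_snd)
  have h := pi_restrict_preimage_inter_eq_map_prod_withDensity (fun c U => Ω c (y, U)) (fun c U => T c (y, U))
    (fun c U g => θ c (y, U) g) (fun c U g => j c (y, U) g) μ ν (hA y) hβ (hAm.comp (hsec y)) hΩy hTy hθy hjy
    (fun c U g => hΩbl c y U g) (fun c U v hv => hright c (y, U) v hv) (fun c U => hlaw c (y, U)) MeasurableSet.univ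
  rw [Measure.restrict_univ, Set.preimage_univ, Set.univ_inter] at h
  exact h.symm

omit [Fintype ι] in
/-- **★ `hfib` WITH A KEPT OUTSIDE PARAMETER**: wherever the Jacobian is non-zero the chart lies over the inside coarse variable (p616307's pointwise fibre identity per `y`:
`T4TriangularPushforward.apply_resample_eq` + `hright`), hence `(J · m)`-a.e. for ANY measure `m`: `A z.1.1 (Φ z) = z.1.2`.
[cite: Balaban1987RG1, (2.4) p.266 and (2.10) p.267 (bookkeeping: the chart parametrises the fibre)] -/
theorem ae_apply_triChart_param_eq (hA : ∀ y, IsLocal β (A y)) (hβ : Injective β)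
    (hright : ∀ c e, ∀ v ∈ T c e, A e.1 (update e.2 (β c) (θ c e v)) c = v)
    (hTm : ∀ c, MeasurableSet {p : (Y × (ι → G)) × G | p.2 ∈ T c p.1})
    (hjm : ∀ c, Measurable fun p : (Y × (ι → G)) × G => j c p.1 p.2)
    (m : Measure ((Y × (κ → G)) × (ι → G))) :
    ∀ᵐ z ∂(m.withDensity fun z =>
        (({z : (Y × (κ → G)) × (ι → G) | ∀ c, z.1.2 c ∈ T c (z.1.1, z.2)}.indicator
          (fun z => ∏ c, j c (z.1.1, z.2) (z.1.2 c)) z : ℝ≥0) : ℝ≥0∞)),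
      A z.1.1 (extend β (fun c => θ c (z.1.1, z.2) (z.1.2 c)) z.2) = z.1.2 := by
  classical
  have hJm : Measurable fun z : (Y × (κ → G)) × (ι → G) =>
      (({z : (Y × (κ → G)) × (ι → G) | ∀ c, z.1.2 c ∈ T c (z.1.1, z.2)}.indicator
        (fun z => ∏ c, j c (z.1.1, z.2) (z.1.2 c)) z : ℝ≥0) : ℝ≥0∞) :=
    measurable_coe_nnreal_ennreal.comp (measurable_triJacobianParam T j hTm hjm)
  rw [ae_withDensity_iff hJm]
  refine ae_of_all _ fun z hz => ?_
  have hmem : ∀ c, z.1.2 c ∈ T c (z.1.1, z.2) := by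
    by_contra hc
    exact hz (by rw [indicator_of_notMem (show z ∉ {z : (Y × (κ → G)) × (ι → G) | ∀ c, z.1.2 c ∈ T c (z.1.1, z.2)} from hc), ENNReal.coe_zero])
  funext c
  rw [apply_resample_eq (hA z.1.1) hβ z.2 (fun c => θ c (z.1.1, z.2) (z.1.2 c)) c]
  exact hright c (z.1.1, z.2) (z.1.2 c) (hmem c)

end Param

end Summit.QuantumFields.YangMills.Theorems.BalabanUVNodesN11PrivateCoordinateChartKeptParameter

end
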